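import Mathlib
import Summits.KontsevichZagierPeriods.Zeta5Search.DenomLaw.LawZA
import Summits.KontsevichZagierPeriods.Zeta5Search.DenomLaw.LawA4PalCoverKit
import Summits.KontsevichZagierPeriods.Zeta5Search.DenomLaw.ZeroPointCoverKit
import Summits.KontsevichZagierPeriods.Zeta5Search.DenomLaw.ZeroCoverKit
import HarnessLib

/-!
# ζ(5) search — a COVER KIT for THEOREM ZA (`SecondOrder.lawZeroPointA4`, `8 − 2M`): the zero-point class structure AND the A⁗′ clauses from a class-type cover — DENOM-LAW prover-d1 gen 20

HONEST FRAMING: systematic search; no irrationality claim unless certified.  Cell `pub-zeta5`, track «DENOM-LAW», seat `denom-prover-d1`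
gen 20 (`HOME/denom-law/prover-d1/ATTEMPT-20.md` §4).  `p`-adic valuation bookkeeping for the explicit rationals `Cas_j(b)`; nothing about ζ(5);
no model exponent moves; records in print UNMOVED.

THEOREM ZA (`DenomLaw/LawZA.lean`) needs the hypotheses of the ZERO-POINT law and of THEOREM A⁗′ in one frame `(M, T)`.  For general-`b`
profile theorems both come FROM A COVER with the kits already in the tree: the zero-point class structure `ZeroWindowClasses b p M D S` with
`|D| + |S| ≤ 1` by gen 17/18's `DenomLaw.zeroClasses_of_cover` (then `ZeroWindows.point_eq_of_classes` makes all live orbit points coincide),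
and the five A⁗′ clauses by gen 20's `DenomLaw.lawA4PalHyps_of_cover`.  This file only assembles: `zeroPointA4_of_classes` (ZA from
`ZeroWindowClasses` + the A⁗′ clauses; degree condition as `p(M − 2) ≤ 2d + 1`), `zeroPointA4_of_cover` (both from one cover and two
spelled-out `List.all` checks; no new definition) and the window wrapper `cover_ZA`.
-/

open Finset

namespace Summit.KontsevichZagierPeriods.Zeta5Search.DenomLaw

open Summit.KontsevichZagierPeriods.Zeta5Search.ClusterValuation
open Summit.KontsevichZagierPeriods.Zeta5Search.CasoratianValuation (InPolytope shift casoratian)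
open Summit.KontsevichZagierPeriods.Zeta5Search.WedgeDictionary (dOf)
open Summit.KontsevichZagierPeriods.Zeta5Search.ClassTypeCover
open Summit.KontsevichZagierPeriods.Zeta5Search.SecondOrder (classTypeList isRaise isRaise2 lawZeroPointA4)
open Summit.KontsevichZagierPeriods.Zeta5Search.ZeroWindows (ZeroWindowClasses point_eq_of_classes)
open Summit.KontsevichZagierPeriods.Zeta5Search.ResidueLaw (sum_classExp_range)

variable {p : ℕ}

/-- **THEOREM ZA from the class structure**: `ZeroWindowClasses b p M D S` with palindromic `D`, `|D| + |S| ≤ 1`, the degree condition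
`p(M − 2) ≤ 2d + 1`, and the five A⁗′ clauses in the frame `(M, T)` give `8 − 2M ≤ v_p(Cas_j(b))`. -/
theorem zeroPointA4_of_classes {b : ℕ → ℤ} {j : ℕ} (hb : InPolytope b) (hb' : InPolytope (shift b j)) (hj1 : 1 ≤ j) (hj7 : j ≤ 7)
    (hpr : p.Prime) (hp5 : 5 ≤ p) (hpb : (p : ℤ) ≤ b 0) (hwin : (b 0 + 2 : ℤ) < (p : ℤ) ^ 2)
    {M : ℕ} (hM : 6 ≤ M) (hMe : Even M) {D S : List (List ℤ)} (hD : ∀ T ∈ D, T.reverse = T) (hlen : D.length + S.length ≤ 1)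
    (hC : ZeroWindowClasses b p M D S) (hdeg : (p : ℤ) * ((M : ℤ) - 2) ≤ 2 * dOf b + 1)
    {T : List ℤ} (hT : T.reverse = T)
    (H1 : ∀ x ∈ multipoleClasses b p, -(M : ℤ) ≤ classExp b p x)
    (H2 : ∀ y, y < p → classPoleCount b p y = 1 → -(M : ℤ) + 1 ≤ classNu b p y)
    (H3 : ∀ x ∈ multipoleClasses b p, classExp b p x = -(M : ℤ) → ¬ CentreIn b p x ∧ classTypeList b p x = T)
    (H4 : ∀ y, y < p → 1 ≤ classPoleCount b p y → classNu b p y = -(M : ℤ) + 1 →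
        isRaise T (classTypeList b p y) = true ∨ (¬ (2 : ℤ) ∣ b 0 ∧ CentreIn b p y ∧ classTypeList b p y = T))
    (H5P : ∀ z, z < p → 1 ≤ classPoleCount b p z → classNu b p z = -(M : ℤ) + 2 →
        isRaise2 T (classTypeList b p z) = true ∨ (classTypeList b p z).reverse = classTypeList b p z)
    (hcas : casoratian b j ≠ 0) : (8 : ℤ) - 2 * M ≤ padicValRat p (casoratian b j) := by
  haveI : Fact p.Prime := ⟨hpr⟩
  have hdeg' : (p : ℤ) * ((M : ℤ) - 2) + ∑ x ∈ range p, classExp b p x ≤ -4 := by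
    rw [sum_classExp_range b hb hp5]; omega
  have G3 : ∀ x, x < p → 1 ≤ classPoleCount b p x → classExp b p x = -(M : ℤ) →
      ¬ CentreIn b p x ∧ (classTypeList b p x).reverse = classTypeList b p x :=
    fun x hx h1 hE => ⟨(hC.2.1 x hx h1 hE).1, hD _ (hC.2.1 x hx h1 hE).2⟩
  refine lawZeroPointA4 b p j M T hb hb' hj1 hj7 hpr hp5 hpb hwin hM hMe hC.1 G3 hdeg' ?_ hT H1 H2 H3 H4 H5P hcas
  intro x hx y hy
  obtain ⟨hW, hV⟩ := point_eq_of_classes b hb hpb hM hMe hD hC hlen hx hy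
  exact ⟨Or.inl (by rw [hW, sub_self]), Or.inl (by rw [hV, sub_self])⟩

/-- **THEOREM ZA from a cover of `b` alone**: the zero-point check of `DenomLaw.zeroClasses_of_cover` (data `D`, `S` with `|D| + |S| ≤ 1`) and the
A⁗′ check of `DenomLaw.lawA4PalHyps_of_cover` (frame `(M, T)`), both spelled out as `List.all` (no new definition), give `8 − 2M ≤ v_p(Cas_j(b))`. -/
theorem zeroPointA4_of_cover {b : ℕ → ℤ} {j : ℕ} (hb : InPolytope b) (hb' : InPolytope (shift b j)) (hj1 : 1 ≤ j) (hj7 : j ≤ 7)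
    (hpr : p.Prime) (hp5 : 5 ≤ p) (hpb : (p : ℤ) ≤ b 0) (hwin : (b 0 + 2 : ℤ) < (p : ℤ) ^ 2)
    {TY : List (List ℤ × Bool)} (hcov : Cover b p TY) {M : ℕ} (hM : 6 ≤ M) (hMe : Even M)
    {D S : List (List ℤ)} (hD : ∀ T ∈ D, T.reverse = T) (hlen : D.length + S.length ≤ 1)
    (hchkZ : (TY.all fun tc =>
      decide (polesL tc.1 = 0) ||
      ((decide (-(M : ℤ) ≤ expL (decide (¬ (2 : ℤ) ∣ b 0)) tc.1 tc.2) &&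
        (!decide (expL (decide (¬ (2 : ℤ) ∣ b 0)) tc.1 tc.2 = -(M : ℤ)) || (!tc.2 && decide (tc.1 ∈ D)))) &&
        (!decide (expL (decide (¬ (2 : ℤ) ∣ b 0)) tc.1 tc.2 = -(M : ℤ) + 1) ||
          (D.any (fun T => isRaise T tc.1 || (decide (¬ (2 : ℤ) ∣ b 0) && tc.2 && decide (tc.1 = T))) ||
            (!tc.2 && (decide (tc.1 ∈ S) || decide (tc.1.reverse ∈ S))))))) = true)
    (hdeg : (p : ℤ) * ((M : ℤ) - 2) ≤ 2 * dOf b + 1) {T : List ℤ} (hT : T.reverse = T)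
    (hchkA : ((TY.all fun tc =>
      (decide (polesL tc.1 < 2) || decide (-(M : ℤ) ≤ expL (decide (¬ (2 : ℤ) ∣ b 0)) tc.1 tc.2)) &&
      (!decide (polesL tc.1 = 1) || decide (-(M : ℤ) + 1 ≤ nuL (decide (¬ (2 : ℤ) ∣ b 0)) tc.1 tc.2)) &&
      (!(decide (2 ≤ polesL tc.1) && decide (expL (decide (¬ (2 : ℤ) ∣ b 0)) tc.1 tc.2 = -(M : ℤ))) || (!tc.2 && decide (tc.1 = T))) &&
      (!(decide (1 ≤ polesL tc.1) && decide (nuL (decide (¬ (2 : ℤ) ∣ b 0)) tc.1 tc.2 = -(M : ℤ) + 1)) ||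
        (isRaise T tc.1 || (decide (¬ (2 : ℤ) ∣ b 0) && tc.2 && decide (tc.1 = T)))) &&
      (!(decide (1 ≤ polesL tc.1) && decide (nuL (decide (¬ (2 : ℤ) ∣ b 0)) tc.1 tc.2 = -(M : ℤ) + 2)) ||
        (isRaise2 T tc.1 || decide (tc.1.reverse = tc.1)))) = true)) (hcas : casoratian b j ≠ 0) :
    (8 : ℤ) - 2 * M ≤ padicValRat p (casoratian b j) := by
  haveI : Fact p.Prime := ⟨hpr⟩
  obtain ⟨H1, H2, H3, H4, H5⟩ := lawA4PalHyps_of_cover hcov hchkA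
  exact zeroPointA4_of_classes hb hb' hj1 hj7 hpr hp5 hpb hwin hM hMe hD hlen (zeroClasses_of_cover hb.1.1 hcov hchkZ) hdeg hT
    H1 H2 H3 H4 H5 hcas

/-- **WINDOW BOUND by THEOREM ZA from a cover**: `c ≤ v_p(Cas_j(b))` whenever `c ≤ 8 − 2M`. -/
theorem cover_ZA {b : ℕ → ℤ} {j : ℕ} (hb : InPolytope b) (hb' : InPolytope (shift b j)) (hj1 : 1 ≤ j) (hj7 : j ≤ 7)
    (hpr : p.Prime) (hp5 : 5 ≤ p) (hpb : (p : ℤ) ≤ b 0) (hwin : (b 0 + 2 : ℤ) < (p : ℤ) ^ 2)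
    {TY : List (List ℤ × Bool)} (hcov : Cover b p TY) {M : ℕ} (hM : 6 ≤ M) (hMe : Even M)
    {D S : List (List ℤ)} (hD : ∀ T ∈ D, T.reverse = T) (hlen : D.length + S.length ≤ 1)
    (hchkZ : (TY.all fun tc =>
      decide (polesL tc.1 = 0) ||
      ((decide (-(M : ℤ) ≤ expL (decide (¬ (2 : ℤ) ∣ b 0)) tc.1 tc.2) &&
        (!decide (expL (decide (¬ (2 : ℤ) ∣ b 0)) tc.1 tc.2 = -(M : ℤ)) || (!tc.2 && decide (tc.1 ∈ D)))) &&
        (!decide (expL (decide (¬ (2 : ℤ) ∣ b 0)) tc.1 tc.2 = -(M : ℤ) + 1) ||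
          (D.any (fun T => isRaise T tc.1 || (decide (¬ (2 : ℤ) ∣ b 0) && tc.2 && decide (tc.1 = T))) ||
            (!tc.2 && (decide (tc.1 ∈ S) || decide (tc.1.reverse ∈ S))))))) = true)
    (hdeg : (p : ℤ) * ((M : ℤ) - 2) ≤ 2 * dOf b + 1) {T : List ℤ} (hT : T.reverse = T)
    (hchkA : ((TY.all fun tc =>
      (decide (polesL tc.1 < 2) || decide (-(M : ℤ) ≤ expL (decide (¬ (2 : ℤ) ∣ b 0)) tc.1 tc.2)) &&
      (!decide (polesL tc.1 = 1) || decide (-(M : ℤ) + 1 ≤ nuL (decide (¬ (2 : ℤ) ∣ b 0)) tc.1 tc.2)) &&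
      (!(decide (2 ≤ polesL tc.1) && decide (expL (decide (¬ (2 : ℤ) ∣ b 0)) tc.1 tc.2 = -(M : ℤ))) || (!tc.2 && decide (tc.1 = T))) &&
      (!(decide (1 ≤ polesL tc.1) && decide (nuL (decide (¬ (2 : ℤ) ∣ b 0)) tc.1 tc.2 = -(M : ℤ) + 1)) ||
        (isRaise T tc.1 || (decide (¬ (2 : ℤ) ∣ b 0) && tc.2 && decide (tc.1 = T)))) &&
      (!(decide (1 ≤ polesL tc.1) && decide (nuL (decide (¬ (2 : ℤ) ∣ b 0)) tc.1 tc.2 = -(M : ℤ) + 2)) ||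
        (isRaise2 T tc.1 || decide (tc.1.reverse = tc.1)))) = true)) {c : ℤ} (hc : c ≤ 8 - 2 * (M : ℤ))
    (hcas : casoratian b j ≠ 0) : c ≤ padicValRat p (casoratian b j) :=
  le_trans hc (zeroPointA4_of_cover hb hb' hj1 hj7 hpr hp5 hpb hwin hcov hM hMe hD hlen hchkZ hdeg hT hchkA hcas)

/-- Sanity of the zero-point check on the census's head ZA instance `b = (24; 11,11,3,3,3,3,1)`, `p = 11` (class types `[1,−6,0]` tame,
`[0,−5,0]ᶜ` at `−5`, `[0,−6,1]` at `−5`, `[−4,−4]` at `−8`; `b₀` even), frame `M = 8`, `D = [[−4,−4]]`, `S = []` (exact `v₁₁(Cas₇) = −8 = 8 − 2M`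
there, casLB = −13). -/
example : (([([1, -6, 0], false), ([0, -5, 0], true), ([0, -6, 1], false), ([-4, -4], false)] : List (List ℤ × Bool)).all fun tc =>
      decide (polesL tc.1 = 0) ||
      ((decide (-((8 : ℕ) : ℤ) ≤ expL false tc.1 tc.2) &&
        (!decide (expL false tc.1 tc.2 = -((8 : ℕ) : ℤ)) || (!tc.2 && decide (tc.1 ∈ ([[-4, -4]] : List (List ℤ)))))) &&
        (!decide (expL false tc.1 tc.2 = -((8 : ℕ) : ℤ) + 1) ||
          (([[-4, -4]] : List (List ℤ)).any (fun T => isRaise T tc.1 || (false && tc.2 && decide (tc.1 = T))) ||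
            (!tc.2 && (decide (tc.1 ∈ ([] : List (List ℤ))) || decide (tc.1.reverse ∈ ([] : List (List ℤ))))))))) = true := by
  decide

/-- … and of the A⁗′ check in the same frame with `T = [−4,−4]`. -/
example : (([([1, -6, 0], false), ([0, -5, 0], true), ([0, -6, 1], false), ([-4, -4], false)] : List (List ℤ × Bool)).all fun tc =>
      (decide (polesL tc.1 < 2) || decide (-((8 : ℕ) : ℤ) ≤ expL false tc.1 tc.2)) &&
      (!decide (polesL tc.1 = 1) || decide (-((8 : ℕ) : ℤ) + 1 ≤ nuL false tc.1 tc.2)) &&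
      (!(decide (2 ≤ polesL tc.1) && decide (expL false tc.1 tc.2 = -((8 : ℕ) : ℤ))) || (!tc.2 && decide (tc.1 = [-4, -4]))) &&
      (!(decide (1 ≤ polesL tc.1) && decide (nuL false tc.1 tc.2 = -((8 : ℕ) : ℤ) + 1)) ||
        (isRaise [-4, -4] tc.1 || (false && tc.2 && decide (tc.1 = [-4, -4])))) &&
      (!(decide (1 ≤ polesL tc.1) && decide (nuL false tc.1 tc.2 = -((8 : ℕ) : ℤ) + 2)) ||
        (isRaise2 [-4, -4] tc.1 || decide (tc.1.reverse = tc.1)))) = true := by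
  decide

end Summit.KontsevichZagierPeriods.Zeta5Search.DenomLaw
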